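/-
Copyright: Literature anchor (statements and proofs after the printed text). No new axioms.
-/
import Mathlib
import Literature.Combinatorics.Hinz2018.DudeneyArray

/-!
# Hinz–Klavžar–Petr (2018), Chapter 5, §5.4 — Theorem 5.14 (Klavžar–Milutinović–Petr [238,
Theorem 6.5]), the part `FS_p^n = F_p^n`: the named fact `FrameMonotonicityTheorem` PROVED

Printed pp. 230–231 (held chunks p0207 l.7–13 and p0208 l.5–11 of
`book:hinz2018-tower-hanoi-myths-maths`). Frame's numbers `F_p^n` minimise over the splittings
`(n_1, …, n_{p-2})` of `n` into superdiscs that satisfy `n_1 ≥ ⋯ ≥ n_{p-2}` — the condition that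
«is called the monotonicity condition and was assumed by Frame to be self-evident.» —, the hatted
numbers `\hat F_p^n` are defined the same way
«except that the monotonicity condition is not required:», and Theorem 5.14 says
`FS_p^n = F_p^n = \hat F_p^n (= A_p^n = \hat A_p^n)`;
«The proof of this theorem is rather lengthy and technical,»
«the interested reader can verify it in [238].» The sibling `EvenMorePegs` PROVED
`\hat F_p^n = FS_p^n` for all `p` (`theorem_5_14_hat`) and `F_p^n = FS_p^n` for `p ≤ 4`, and
recorded the general monotone part as the NAMED FACT
`FrameMonotonicityTheorem : ∀ p n, 3 ≤ p → frameNum true p n = frameStewartP p n`. This file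
PROVES it (`frameMonotonicityTheorem`), for every `p` (the junk levels `p ≤ 2` included:
`theorem_5_14`).

OUR PROOF (not the one of [238]) is an exchange argument resting on Theorem 5.27 of §5.5.3 (the
sibling `DudeneyArray`, `frameStewartP_eq_phiSeq`): `FS_q^{m+1} - FS_q^m = 2^{∇_{q-2,m}}`, and the
hypertetrahedral root is antitone in the number of pegs (`hyperRoot_anti_left`), so the increments
of `FS_q` are pointwise LARGER for FEWER pegs: `FS_{q'}^{a+d} + FS_q^a ≤ FS_{q'}^a + FS_q^{a+d}` for
`3 ≤ q ≤ q'` (`frameStewartP_exchange`). In a splitting with an inversion `n_i < n_j`, `i < j`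
(superdisc `i` travels on more pegs than superdisc `j`), swapping the two parts therefore does not
increase `Σ_i FS_{p-i}^{n_i}` (`cost_swap_le`) and strictly decreases `Σ_i i·n_i`, so every
splitting is dominated by a non-increasing one with the same sum (`exists_antitone_le`); hence the
minimum over the monotone splittings equals the minimum over all splittings
(`framePartitions_true_inf_eq`), and strong induction on `p` and `n` through the displayed
minimum (`frameNumBar_eq_inf'`) and `theorem_5_14_hat` gives `F = \hat F = FS`
(`frameNumBar_true_eq_false`, `frameNum_true_eq_false`, `theorem_5_14`). (For Stewart's recursion
(5.3) itself the analogous condition `m ≥ n - m` WOULD lose —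
«However, this would lead to larger values which is not what we want to have.», the sibling's
`frameStewartP_five_nine` —; for Frame's splittings it is harmless.) Consequences: Frame's
half-way numbers are the Frame–Stewart half-way numbers (`two_mul_frameNumBar_true_add_one`,
`frameNumBar_true_eq_frameStewartBarP`), and an optimal splitting satisfying the monotonicity
condition exists (`exists_antitone_optimal`). The parts `A_p^n`, `\hat A_p^n` of Theorem 5.14 stay
NOT TYPED (as in the sibling).

Checked independently by direct computation of `F`, `\hat F`, `FS` from the displayed recursions
(`p ≤ 8`, 140 cells), of the exchange inequality (9 300 cells) and of the sorting step (75 cells).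
-/

namespace Literature.Combinatorics.Hinz2018.FrameMonotonicity

open Finset

/-! ## Increments of the Frame–Stewart numbers: fewer pegs, larger increments -/

/-- (Theorem 5.27 of §5.5.3 BY NAME, as increments) `FS_p^{m+1} = FS_p^m + 2^{∇_{p-2,m}}` for
`p ≥ 3`. [cite: HinzKlavzarPetr2018, Ch. 5 §5.5.3, Theorem 5.27, p. 245] -/
theorem frameStewartP_succ_eq {p : ℕ} (hp : 3 ≤ p) (m : ℕ) :
    frameStewartP p (m + 1) = frameStewartP p m + 2 ^ hyperRoot (p - 2) m := by
  rw [frameStewartP_eq_phiSeq hp, frameStewartP_eq_phiSeq hp, sum_range_succ]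

/-- (ours, glue) A block of increments: `FS_p^{a+d} = FS_p^a + Σ_{k<d} 2^{∇_{p-2,a+k}}` (`p ≥ 3`).
[cite: HinzKlavzarPetr2018, Ch. 5 §5.5.3, Theorem 5.27, p. 245] -/
theorem frameStewartP_add_eq {p : ℕ} (hp : 3 ≤ p) (a d : ℕ) :
    frameStewartP p (a + d) = frameStewartP p a + ∑ k ∈ range d, 2 ^ hyperRoot (p - 2) (a + k) := by
  rw [frameStewartP_eq_phiSeq hp, frameStewartP_eq_phiSeq hp, sum_range_add]

/-- (ours) THE EXCHANGE INEQUALITY. For `3 ≤ q ≤ q'` the increments of `FS_q` dominate those of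
`FS_{q'}` («\nabla_{h+1,k} \leq \nabla_{h,k} \leq k», p. 242, with Theorem 5.27):
`FS_{q'}^{a+d} + FS_q^a ≤ FS_{q'}^a + FS_q^{a+d}`.
[cite: HinzKlavzarPetr2018, Ch. 5 §5.5.3, Theorem 5.27, p. 245; Ch. 5 §5.5.2, (5.19), p. 242] -/
theorem frameStewartP_exchange {q q' : ℕ} (hq : 3 ≤ q) (hqq : q ≤ q') (a d : ℕ) :
    frameStewartP q' (a + d) + frameStewartP q a ≤
      frameStewartP q' a + frameStewartP q (a + d) := by
  rw [frameStewartP_add_eq (hq.trans hqq), frameStewartP_add_eq hq]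
  have h : ∑ k ∈ range d, 2 ^ hyperRoot (q' - 2) (a + k) ≤
      ∑ k ∈ range d, 2 ^ hyperRoot (q - 2) (a + k) :=
    sum_le_sum fun k _ => Nat.pow_le_pow_right (by norm_num)
      (hyperRoot_anti_left (h := q - 2) (h' := q' - 2) (by omega) (by omega) (a + k))
  omega

/-- (ours) The exchange inequality with `a ≤ b`: `FS_{q'}^b + FS_q^a ≤ FS_{q'}^a + FS_q^b` for
`3 ≤ q ≤ q'` — moving discs from a superdisc with fewer pegs to one with more pegs never costs.
[cite: HinzKlavzarPetr2018, Ch. 5 §5.5.3, Theorem 5.27, p. 245] -/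
theorem frameStewartP_exchange' {q q' : ℕ} (hq : 3 ≤ q) (hqq : q ≤ q') {a b : ℕ} (hab : a ≤ b) :
    frameStewartP q' b + frameStewartP q a ≤ frameStewartP q' a + frameStewartP q b := by
  obtain ⟨d, rfl⟩ := Nat.exists_eq_add_of_le hab
  exact frameStewartP_exchange hq hqq a d

/-! ## Sorting a splitting: the exchange argument -/

/-- (ours, glue) Splitting a sum over `Fin k` at two indices. [folklore] -/
private theorem sum_split {k : ℕ} (F : Fin k → ℕ) {i j : Fin k} (hne : i ≠ j) :
    ∑ m, F m = F i + (F j + ∑ m ∈ (univ.erase i).erase j, F m) := by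
  rw [← add_sum_erase _ F (mem_univ i), ← add_sum_erase _ F (mem_erase.2 ⟨hne.symm, mem_univ j⟩)]

/-- (ours, glue) Off the two swapped indices nothing changes. [folklore] -/
private theorem sum_erase_erase_swap {k : ℕ} (F : Fin k → ℕ → ℕ) (f : Fin k → ℕ) {i j : Fin k} :
    ∑ m ∈ (univ.erase i).erase j, F m ((f ∘ ⇑(Equiv.swap i j)) m) =
      ∑ m ∈ (univ.erase i).erase j, F m (f m) :=
  sum_congr rfl fun m hm => by
    rw [Function.comp_apply, Equiv.swap_apply_of_ne_of_ne
      (ne_of_mem_erase (mem_of_mem_erase hm)) (ne_of_mem_erase hm)]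

/-- (ours) ONE EXCHANGE. For costs `c_0, …, c_{k-1} : ℕ → ℕ` whose increments grow with the index
(`c_i(a+d) + c_j(a) ≤ c_i(a) + c_j(a+d)` for `i < j`), swapping the parts of a splitting at an
inversion `f i ≤ f j`, `i < j`, does not increase the total cost `Σ_m c_m(f m)`.
[cite: HinzKlavzarPetr2018, Ch. 5 §5.4, Theorem 5.14, pp. 230–231] -/
theorem cost_swap_le {k : ℕ} (c : Fin k → ℕ → ℕ)
    (hc : ∀ i j : Fin k, i < j → ∀ a d : ℕ, c i (a + d) + c j a ≤ c i a + c j (a + d))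
    (f : Fin k → ℕ) {i j : Fin k} (hij : i < j) (hf : f i ≤ f j) :
    ∑ m, c m ((f ∘ ⇑(Equiv.swap i j)) m) ≤ ∑ m, c m (f m) := by
  have hne : i ≠ j := hij.ne
  rw [sum_split (fun m => c m ((f ∘ ⇑(Equiv.swap i j)) m)) hne, sum_split (fun m => c m (f m)) hne,
    sum_erase_erase_swap c f, Function.comp_apply, Function.comp_apply, Equiv.swap_apply_left,
    Equiv.swap_apply_right]
  obtain ⟨d, hd⟩ := Nat.exists_eq_add_of_le hf
  rw [hd]
  have h := hc i j hij (f i) d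
  omega

/-- (ours) … and strictly decreases the weight `Σ_m m · (f m)` when the inversion is strict.
[cite: HinzKlavzarPetr2018, Ch. 5 §5.4, Theorem 5.14, pp. 230–231] -/
theorem weight_swap_lt {k : ℕ} (f : Fin k → ℕ) {i j : Fin k} (hij : i < j) (hf : f i < f j) :
    ∑ m : Fin k, (m : ℕ) * (f ∘ ⇑(Equiv.swap i j)) m < ∑ m : Fin k, (m : ℕ) * f m := by
  have hne : i ≠ j := hij.ne
  rw [sum_split (fun m : Fin k => (m : ℕ) * (f ∘ ⇑(Equiv.swap i j)) m) hne,
    sum_split (fun m : Fin k => (m : ℕ) * f m) hne,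
    sum_erase_erase_swap (fun (m : Fin k) x => (m : ℕ) * x) f,
    Function.comp_apply, Function.comp_apply, Equiv.swap_apply_left, Equiv.swap_apply_right]
  obtain ⟨d, hd⟩ := Nat.exists_eq_add_of_lt hf
  rw [hd]
  have hij' : (i : ℕ) < j := hij
  have h2 : (i : ℕ) * (d + 1) < j * (d + 1) := mul_lt_mul_of_pos_right hij' (Nat.succ_pos d)
  nlinarith [h2]

/-- (ours) SORTING. Under the exchange hypothesis every splitting `f` is dominated by a splitting
`g` satisfying the monotonicity condition (`g` non-increasing) with the same number of discs and
no larger cost (induction on the weight `Σ_m m · (f m)`, one exchange at a time).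
[cite: HinzKlavzarPetr2018, Ch. 5 §5.4, Theorem 5.14, pp. 230–231] -/
theorem exists_antitone_le {k : ℕ} (c : Fin k → ℕ → ℕ)
    (hc : ∀ i j : Fin k, i < j → ∀ a d : ℕ, c i (a + d) + c j a ≤ c i a + c j (a + d))
    (f : Fin k → ℕ) :
    ∃ g : Fin k → ℕ, Antitone g ∧ ∑ m, g m = ∑ m, f m ∧ ∑ m, c m (g m) ≤ ∑ m, c m (f m) := by
  suffices h : ∀ (N : ℕ) (f : Fin k → ℕ), ∑ m : Fin k, (m : ℕ) * f m = N →
      ∃ g : Fin k → ℕ, Antitone g ∧ ∑ m, g m = ∑ m, f m ∧ ∑ m, c m (g m) ≤ ∑ m, c m (f m) from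
    h _ f rfl
  intro N
  induction N using Nat.strong_induction_on with
  | _ N ih =>
    intro f hN
    by_cases hf : Antitone f
    · exact ⟨f, hf, rfl, le_rfl⟩
    · have hf' : ¬ ∀ a b : Fin k, a ≤ b → f b ≤ f a := fun h => hf fun a b hab => h a b hab
      push Not at hf'
      obtain ⟨i, j, hij, hlt⟩ := hf'
      have hij' : i < j := lt_of_le_of_ne hij fun h => (lt_irrefl (f j)) (by rwa [h] at hlt)
      have hsum : ∑ m, (f ∘ ⇑(Equiv.swap i j)) m = ∑ m, f m := by
        simp only [Function.comp_apply]
        exact Equiv.sum_comp (Equiv.swap i j) f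
      obtain ⟨g, hg, hgs, hgc⟩ := ih _ (hN ▸ weight_swap_lt f hij' hlt) (f ∘ ⇑(Equiv.swap i j)) rfl
      exact ⟨g, hg, hgs.trans hsum, hgc.trans (cost_swap_le c hc f hij' hlt.le)⟩

/-- (ours) MONOTONICITY IS HARMLESS for exchangeable costs: the minimum of `Σ_m c_m(n_m)` over the
splittings of `n` satisfying the monotonicity condition equals the minimum over all splittings
(`framePartitions true` versus `framePartitions false` of the sibling).
[cite: HinzKlavzarPetr2018, Ch. 5 §5.4, Theorem 5.14, pp. 230–231] -/
theorem framePartitions_true_inf_eq {k : ℕ} (hk : 1 ≤ k) (n : ℕ) (c : Fin k → ℕ → ℕ)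
    (hc : ∀ i j : Fin k, i < j → ∀ a d : ℕ, c i (a + d) + c j a ≤ c i a + c j (a + d)) :
    (framePartitions true k n).inf' (framePartitions_nonempty true hk n) (fun f => ∑ m, c m (f m)) =
      (framePartitions false k n).inf' (framePartitions_nonempty false hk n)
        (fun f => ∑ m, c m (f m)) := by
  refine le_antisymm ((le_inf'_iff _ _).2 fun f hf => ?_) ((le_inf'_iff _ _).2 fun f hf => ?_)
  · obtain ⟨hs, -⟩ := mem_framePartitions.1 hf
    obtain ⟨g, hg, hgs, hgc⟩ := exists_antitone_le c hc f
    have hmem : g ∈ framePartitions true k n :=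
      mem_framePartitions.2 ⟨by rw [hgs, hs], fun _ => hg⟩
    exact (inf'_le _ hmem).trans hgc
  · obtain ⟨hs, -⟩ := mem_framePartitions.1 hf
    exact inf'_le _ (mem_framePartitions.2 ⟨hs, fun h => Bool.noConfusion h⟩)

/-! ## Theorem 5.14: `F_p^n = \hat F_p^n = FS_p^n` -/

/-- (ours, glue) A part of a splitting of `n` is at most `n`. [folklore] -/
private theorem apply_le_of_sum_eq {k n : ℕ} {f : Fin k → ℕ} (h : ∑ i, f i = n) (i : Fin k) :
    f i ≤ n := by
  rw [← h]; exact single_le_sum (fun _ _ => Nat.zero_le _) (mem_univ i)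

/-- (ours) The Frame–Stewart costs of Frame's splittings are exchangeable: superdisc `i` (from `0`)
travels on `p - i` pegs, and for `i < j` the increments of `FS_{p-j} = \hat F_{p-j}` dominate those
of `FS_{p-i} = \hat F_{p-i}`. [cite: HinzKlavzarPetr2018, Ch. 5 §5.4, Theorem 5.14, pp. 230–231] -/
theorem frameNum_false_exchange (p : ℕ) (i j : Fin (p - 2)) (hij : i < j) (a d : ℕ) :
    frameNum false (p - i) (a + d) + frameNum false (p - j) a ≤
      frameNum false (p - i) a + frameNum false (p - j) (a + d) := by
  have hij' : (i : ℕ) < j := hij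
  have hj := j.isLt
  simp only [theorem_5_14_hat]
  exact frameStewartP_exchange (q := p - j) (q' := p - i) (by omega) (by omega) a d

/-- **Theorem 5.14**, the part `F = \hat F` at the level of the half-way numbers: `\overline{F}_p^n
= \hat{\overline F}_p^n` for all `p`, `n` — the monotonicity condition does not change Frame's
numbers (strong induction on `p` and `n`: below level `(p, n)` the two families agree, so on the
monotone splittings the two cost functions coincide, and by the exchange argument the monotone
minimum of the hatted costs is the unrestricted minimum). PROVED (ours).
[cite: HinzKlavzarPetr2018, Ch. 5 §5.4, Theorem 5.14, pp. 230–231] -/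
theorem frameNumBar_true_eq_false (p n : ℕ) : frameNumBar true p n = frameNumBar false p n := by
  induction p using Nat.strong_induction_on generalizing n with
  | _ p ihp =>
    induction n using Nat.strong_induction_on with
    | _ n ihn =>
      rcases Nat.lt_or_ge p 3 with hp | hp
      · rw [frameNumBar_of_le_three true (by omega), frameNumBar_of_le_three false (by omega)]
      · have hk : 1 ≤ p - 2 := by omega
        have key : ∀ (i : Fin (p - 2)) (m : ℕ), m ≤ n →
            frameNum true (p - i) m = frameNum false (p - i) m := by
          intro i m hm
          cases m with
          | zero => rfl
          | succ m =>
            rw [frameNum_succ, frameNum_succ]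
            rcases Nat.eq_zero_or_pos (i : ℕ) with hi | hi
            · rw [hi, Nat.sub_zero, ihn m (by omega)]
            · rw [ihp (p - i) (by omega) m]
        have hpt : ∀ f ∈ framePartitions true (p - 2) n,
            (∑ i : Fin (p - 2), frameNum true (p - i) (f i)) =
              ∑ i : Fin (p - 2), frameNum false (p - i) (f i) :=
          fun f hf => sum_congr rfl fun i _ =>
            key i (f i) (apply_le_of_sum_eq (mem_framePartitions.1 hf).1 i)
        have e1 : frameNumBar true p n = (framePartitions true (p - 2) n).inf'
            (framePartitions_nonempty true hk n)
              (fun f => ∑ i : Fin (p - 2), frameNum false (p - i) (f i)) :=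
          (frameNumBar_eq_inf' true hp n).trans (inf'_congr _ rfl hpt)
        rw [e1, frameNumBar_eq_inf' false hp n]
        exact framePartitions_true_inf_eq hk n
          (fun (i : Fin (p - 2)) m => frameNum false (p - i) m)
          (frameNum_false_exchange p)

/-- **Theorem 5.14**, the part `F_p^n = \hat F_p^n`, for all `p` and `n`. PROVED (ours).
[cite: HinzKlavzarPetr2018, Ch. 5 §5.4, Theorem 5.14, pp. 230–231] -/
theorem frameNum_true_eq_false (p n : ℕ) : frameNum true p n = frameNum false p n := by
  cases n with
  | zero => rfl
  | succ n => rw [frameNum_succ, frameNum_succ, frameNumBar_true_eq_false]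

/-- **Theorem 5.14** (Klavžar, Milutinović, and Petr [238, Theorem 6.5]), the part `FS_p^n =
F_p^n`: Frame's numbers WITH the monotonicity condition are the Frame–Stewart numbers, for every
`p` and `n` (the junk levels `p ≤ 2` included). PROVED (ours: the exchange argument above and the
sibling's `theorem_5_14_hat`; the book defers the proof:
«The proof of this theorem is rather lengthy and technical,»
«the interested reader can verify it in [238].»; [238, Theorem 6.5] = `KlavzarMilutinovicPetr2002`).
[cite: HinzKlavzarPetr2018, Ch. 5 §5.4, Theorem 5.14, pp. 230–231] -/
theorem theorem_5_14 (p n : ℕ) : frameNum true p n = frameStewartP p n := by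
  rw [frameNum_true_eq_false, theorem_5_14_hat]

/-- THE NAMED FACT `FrameMonotonicityTheorem` of the sibling `EvenMorePegs` (Theorem 5.14, the part
`FS_p^n = F_p^n` for `p ≥ 3`) HOLDS.
[cite: HinzKlavzarPetr2018, Ch. 5 §5.4, Theorem 5.14, pp. 230–231] -/
theorem frameMonotonicityTheorem : FrameMonotonicityTheorem := fun p n _ => theorem_5_14 p n

/-- **Theorem 5.14** as printed, the `F`-parts —
«Then the main result of Klavžar, Milutinović, and Petr [238, Theorem 6.5] reads as follows:»
for `p ∈ ℕ_3` and `n ∈ ℕ_0`, `FS_p^n = F_p^n = \hat F_p^n` (the parts `A_p^n`, `\hat A_p^n` are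
NOT TYPED). [cite: HinzKlavzarPetr2018, Ch. 5 §5.4, Theorem 5.14, pp. 230–231] -/
theorem theorem_5_14_printed {p : ℕ} (hp : 3 ≤ p) (n : ℕ) :
    frameStewartP p n = frameNum true p n ∧ frameNum true p n = frameNum false p n :=
  ⟨(frameMonotonicityTheorem p n hp).symm, frameNum_true_eq_false p n⟩

/-- Frame's half-way numbers are the Frame–Stewart half-way numbers: `2\overline{F}_p^n + 1 =
FS_p^{n+1}` for all `p`, `n`. [cite: HinzKlavzarPetr2018, Ch. 5 §5.4, Theorem 5.14, pp. 230–231] -/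
theorem two_mul_frameNumBar_true_add_one (p n : ℕ) :
    2 * frameNumBar true p n + 1 = frameStewartP p (n + 1) := by
  rw [← theorem_5_14, frameNum_succ]

/-- … i.e. `\overline{F}_p^n = \overline{FS}_p^n` (the sibling `DudeneyArray`'s `frameStewartBarP`,
Theorem 5.27). [cite: HinzKlavzarPetr2018, Ch. 5 §5.4, Theorem 5.14, pp. 230–231] -/
theorem frameNumBar_true_eq_frameStewartBarP (p n : ℕ) :
    frameNumBar true p n = frameStewartBarP p n := by
  unfold frameStewartBarP
  have h := two_mul_frameNumBar_true_add_one p n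
  omega

/-- (ours) For every splitting of `n` into `p - 2` superdiscs there is one satisfying the
monotonicity condition, with the same number of discs and no larger Frame–Stewart cost
`Σ_i FS_{p-i}^{n_{i+1}}` (`p ≥ 3`).
[cite: HinzKlavzarPetr2018, Ch. 5 §5.4, Theorem 5.14, pp. 230–231] -/
theorem exists_antitone_frameStewartP_le {p : ℕ} (hp : 3 ≤ p) (f : Fin (p - 2) → ℕ) :
    ∃ g : Fin (p - 2) → ℕ, Antitone g ∧ ∑ i, g i = ∑ i, f i ∧
      ∑ i : Fin (p - 2), frameStewartP (p - i) (g i) ≤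
        ∑ i : Fin (p - 2), frameStewartP (p - i) (f i) := by
  refine exists_antitone_le (fun (i : Fin (p - 2)) m => frameStewartP (p - i) m)
    (fun i j hij a d => ?_) f
  have hij' : (i : ℕ) < j := hij
  have hj := j.isLt
  have hp' := hp
  exact frameStewartP_exchange (q := p - j) (q' := p - i) (by omega) (by omega) a d

/-- (ours) Frame's strategy WITH the monotonicity condition is optimal among Frame's strategies:
for `p ≥ 3` some splitting `n_1 ≥ ⋯ ≥ n_{p-2}` of `n` realises `\overline{F}_p^n = \overline{FS}_p^n
= Σ_i FS_{p-i}^{n_{i+1}}`. [cite: HinzKlavzarPetr2018, Ch. 5 §5.4, Theorem 5.14, pp. 230–231] -/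
theorem exists_antitone_optimal {p : ℕ} (hp : 3 ≤ p) (n : ℕ) :
    ∃ f : Fin (p - 2) → ℕ, Antitone f ∧ ∑ i, f i = n ∧
      frameNumBar true p n = ∑ i : Fin (p - 2), frameStewartP (p - i) (f i) := by
  obtain ⟨f, hf, hfe⟩ := exists_mem_eq_inf' (framePartitions_nonempty true (by omega : 1 ≤ p - 2) n)
    (fun f : Fin (p - 2) → ℕ => ∑ i : Fin (p - 2), frameNum true (p - i) (f i))
  obtain ⟨hs, hmono⟩ := mem_framePartitions.1 hf
  refine ⟨f, hmono rfl, hs, ?_⟩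
  rw [frameNumBar_eq_inf' true hp n, hfe]
  exact sum_congr rfl fun i _ => theorem_5_14 _ _

/-- Values: `F_6^n = \hat F_6^n = FS_6^n = 0, 1, 3, 5, 7, 9, 13` for `n ≤ 6` (the theorem
instantiated; the `FS_6` values by `decide`, cf. the sibling's `frameStewartP_six_prefix`).
[cite: HinzKlavzarPetr2018, Ch. 5 §5.4, Theorem 5.14, pp. 230–231] -/
theorem frameNum_true_six_values :
    (List.range 7).map (frameNum true 6) = [0, 1, 3, 5, 7, 9, 13] := by
  have h : (List.range 7).map (frameNum true 6) = (List.range 7).map (frameStewartP 6) :=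
    List.map_congr_left fun n _ => theorem_5_14 6 n
  rw [h]
  decide

end Literature.Combinatorics.Hinz2018.FrameMonotonicity
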